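import Literature.NumberTheory.EllipticCurves.ComplexMultiplicationShaRubinHomDescentProofs
import Literature.NumberTheory.EllipticCurves.TorsionPairingOrderThreeInvariant
import Literature.NumberTheory.EllipticCurves.HuShuYin2019.SylvesterPairNoFixedTwoPowerTorsion
import HarnessLib

/-!
# The `2`-power torsion of a curve with a CM operator of order `3` as a Galois LINE over `𝒪/2^M`

Topic `NumberTheory/EllipticCurves`; namespaces `Literature.NumberTheory.EllipticCurves.CMTorsionLine` (abstract
core) and `….JZero` (curves). THEOREMS ONLY: **no definition and no named fact** (D-0026). `E = W/K`, `X := E[n]`,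
`n = 2^M` (`M ≥ 1`), `fn : X →+ X` additive, `Γ_K`-equivariant, with `fn ∘ fn + fn + 1 = 0` (the CM operator `[ζ]` of
a `j = 0` curve over `K ∋ ζ`, bound as in `JZero.exists_cm_operator_galH1Torsion`). The `2`-POWER analogue of the
tree's PRIME-level CM inputs `exists_mem_torsionFixing_mul_eq` / `bijective_smul_sub_of_not_mem_torsionFixing`:
(α) `X` is free of rank one over `(ℤ/2^M)[fn] ≅ 𝒪/2^M` (`JZero.exists_basis_pair_geomTorsion_two_pow`), every
`σ ∈ Γ_K` acts as `a + b·fn` (`JZero.smul_eq_zsmul_add_zsmul_fn`), so `Γ_K` acts through COMMUTING operators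
(`JZero.smul_comm_geomTorsion_two_pow`, `JZero.exists_mem_torsionFixing_mul_eq_two_pow` = the `hab` input of the
tree's Sah form `Rubin1987.subgroupResKer_torsionFixing_eq_bot`); (β) if `Γ_K` has no non-zero fixed vector on `X`,
some `z ∈ Γ_K` has `P ↦ z • P - P` BIJECTIVE on `X` (`JZero.exists_bijective_smul_sub_two_pow`: `z` acts as a unit
`u ≢ 1 (mod 2)` of `𝒪/2^M` — the order-`3` scalar); (γ) hence `ker (H¹(K, E[2^M]) → H¹(K(E[2^M]), E[2^M])) = 0`
(`JZero.subgroupResKer_torsionFixing_two_pow_eq_bot`) and a class is determined by its values `[x, ρ]`,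
`ρ ∈ Γ_{K(E[2^M])}` (`JZero.eq_zero_of_forall_h1Eval_eq_zero_two_pow`); for `y² = x³ + b` with `x³ + b` rootless over
`K` the no-fixed-vector input is the tree's `JZero.geomTorsion_eq_zero_of_forall_smul_eq` (`…_of_no_cubeRoot`);
(δ) an element fixing `E[2]` pointwise has `g ^ 2^(M-1) ∈ Γ_{K(E[2^M])}`
(`JZero.pow_two_pow_mem_torsionFixing_of_forall_two_torsion`): the unique cubic subfield of `K(E[2^∞])` is `K(E[2])`.

## References

* [Rubin1999] K. Rubin, *Elliptic curves with complex multiplication and the conjecture of Birch and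
  Swinnerton-Dyer*, LNM 1716 (1999), Cor. 5.5, Cor. 5.20, Lemma 6.1, Lemma 6.2 (i), Thm. 6.5.
* [GrossLMS1991] B. H. Gross, *Kolyvagin's work on modular elliptic curves*, LMS LN 153 (1991), §9.
* [McCallumLMS1991] W. G. McCallum, *Kolyvagin's work on Shafarevich–Tate groups* (1991), §3.
* [SilvermanAEC2009] J. H. Silverman, *The Arithmetic of Elliptic Curves*, 2nd ed., Cor. III.6.4(b).
-/



noncomputable section
open scoped Classical
universe u

namespace Literature.NumberTheory.EllipticCurves

open _root_.WeierstrassCurve Field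

/-! ## §1 Abstract core: an additive group killed by `2^M` with an operator `fn`, `fn² + fn + 1 = 0` -/

namespace CMTorsionLine

variable {X : Type*} [AddCommGroup X] (fn : X →+ X) (hrel : ∀ Q, fn (fn Q) + fn Q + Q = 0)
include hrel

/-- `fn³ = 1` from `fn² + fn + 1 = 0`. [cite: Rubin1999, Cor. 5.5] -/
theorem fn_fn_fn (Q : X) : fn (fn (fn Q)) = Q := by
  have e1 : ∀ Q, fn (fn Q) = -fn Q - Q := fun Q ↦ by rw [← sub_eq_zero, ← hrel Q]; abel
  rw [e1 (fn Q), e1 Q]; abel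

/-- `fn` is injective. [cite: Rubin1999, Cor. 5.5] -/
theorem fn_injective : Function.Injective fn := fun P Q h ↦ by
  rw [← fn_fn_fn fn hrel P, ← fn_fn_fn fn hrel Q, h]

/-- A `2`-torsion element fixed by `fn` is zero (`3R = 0` and `2R = 0`). [cite: Rubin1999, Cor. 5.5] -/
theorem eq_zero_of_two_smul_of_fn_eq {R : X}
    (h2 : (2 : ℤ) • R = 0) (hR : fn R = R) : R = 0 := by
  have h3 : R + R + R = 0 := by simpa [hR] using hrel R
  have h2' : R + R = 0 := by rwa [two_zsmul] at h2
  rwa [h2', zero_add] at h3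

/-- A `2`-torsion element `R` with `fn R + R = 0` is zero (`fn R = -R = R`). [cite: Rubin1999, Cor. 5.5] -/
theorem eq_zero_of_two_smul_of_fn_add_eq {R : X}
    (h2 : (2 : ℤ) • R = 0) (hR : fn R + R = 0) : R = 0 := by
  have hneg : -R = R := by
    rw [neg_eq_iff_add_eq_zero, ← two_zsmul]; exact h2
  have hfix : fn R = R := by rw [eq_neg_of_add_eq_zero_left hR, hneg]
  exact eq_zero_of_two_smul_of_fn_eq fn hrel h2 hfix

/-- **`2`-torsion independence**: for `R ≠ 0` with `2R = 0`, `a • R + b • fn R = 0` forces `a, b` even.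
[cite: Rubin1999, Cor. 5.5] -/
theorem even_of_zsmul_add_zsmul_fn_eq_zero {R : X}
    (h2 : (2 : ℤ) • R = 0) (hR : R ≠ 0) {a b : ℤ} (h : a • R + b • fn R = 0) :
    (2 : ℤ) ∣ a ∧ (2 : ℤ) ∣ b := by
  -- reduce the coefficients mod 2: `(2c) • S = 0`, `(2c + 1) • S = S` on `2`-torsion
  have h2' : (2 : ℤ) • fn R = 0 := by rw [← map_zsmul, h2, map_zero]
  have hev : ∀ (c : ℤ) (S : X), (2 : ℤ) • S = 0 → (2 * c) • S = 0 := fun c S hS ↦ by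
    rw [mul_comm, mul_smul, hS, smul_zero]
  have hodd : ∀ (c : ℤ) (S : X), (2 : ℤ) • S = 0 → (2 * c + 1) • S = S := fun c S hS ↦ by
    rw [add_smul, hev c S hS, zero_add, one_smul]
  obtain ⟨c, rfl | rfl⟩ := Int.even_or_odd' a <;> obtain ⟨d, rfl | rfl⟩ := Int.even_or_odd' b
  · exact ⟨⟨c, rfl⟩, ⟨d, rfl⟩⟩
  · rw [hev c R h2, zero_add, hodd d (fn R) h2'] at h
    exact absurd (fn_injective fn hrel (by rw [h, map_zero])) hR
  · rw [hodd c R h2, hev d (fn R) h2', add_zero] at h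
    exact absurd h hR
  · rw [hodd c R h2, hodd d (fn R) h2', add_comm] at h
    exact absurd (eq_zero_of_two_smul_of_fn_add_eq fn hrel h2 h) hR

variable {M : ℕ} (hkill : ∀ Q : X, ((2 : ℤ) ^ M) • Q = 0) {P₀ : X} (hP₀ : ((2 : ℤ) ^ (M - 1)) • P₀ ≠ 0)
include hkill hP₀

/-- **Independence over `ℤ/2^M`**: if `2^M` kills `X`, `2^{M-1} P₀ ≠ 0` and `a • P₀ + b • fn P₀ = 0`, then
`2^M ∣ a, b` (induction on the `2`-adic valuation, down to the `2`-torsion layer). [cite: Rubin1999, Cor. 5.5] -/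
theorem two_pow_dvd_of_zsmul_add_zsmul_fn_eq_zero {a b : ℤ} (h : a • P₀ + b • fn P₀ = 0) :
    (2 : ℤ) ^ M ∣ a ∧ (2 : ℤ) ^ M ∣ b := by
  have hM : 1 ≤ M := Nat.one_le_iff_ne_zero.mpr fun h0 ↦ hP₀ (by subst h0; simpa using hkill P₀)
  -- `2^k ∣ a ∧ 2^k ∣ b` for all `k ≤ M`, by induction
  suffices key : ∀ k, k ≤ M → (2 : ℤ) ^ k ∣ a ∧ (2 : ℤ) ^ k ∣ b from key M le_rfl
  intro k
  induction k with
  | zero => exact fun _ ↦ ⟨by simp, by simp⟩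
  | succ k ih =>
    intro hk
    obtain ⟨⟨a', rfl⟩, ⟨b', rfl⟩⟩ := ih (Nat.le_of_succ_le hk)
    -- `Q := a' P₀ + b' fn P₀` is killed by `2^k`, `k ≤ M - 1`, hence by `2^{M-1}`
    have hkQ : ((2 : ℤ) ^ k) • (a' • P₀ + b' • fn P₀) = 0 := by
      rw [smul_add, smul_smul, smul_smul]; exact h
    have hQ : ((2 : ℤ) ^ (M - 1)) • (a' • P₀ + b' • fn P₀) = 0 := by
      obtain ⟨d, hd⟩ : ∃ d, M - 1 = k + d := ⟨M - 1 - k, by omega⟩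
      rw [hd, pow_add, mul_comm, mul_smul, hkQ, smul_zero]
    -- reduce to the `2`-torsion layer with `R := 2^{M-1} P₀`
    have h2R : (2 : ℤ) • (((2 : ℤ) ^ (M - 1)) • P₀) = 0 := by
      rw [smul_smul, ← pow_succ', Nat.sub_add_cancel hM]; exact hkill P₀
    have h' : a' • (((2 : ℤ) ^ (M - 1)) • P₀) + b' • fn (((2 : ℤ) ^ (M - 1)) • P₀) = 0 := by
      have e : a' • (((2 : ℤ) ^ (M - 1)) • P₀) + b' • fn (((2 : ℤ) ^ (M - 1)) • P₀) =
          ((2 : ℤ) ^ (M - 1)) • (a' • P₀ + b' • fn P₀) := by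
        rw [map_zsmul, smul_add, smul_smul, smul_smul, smul_smul, smul_smul, mul_comm a', mul_comm b']
      rw [e]; exact hQ
    obtain ⟨⟨a'', rfl⟩, ⟨b'', rfl⟩⟩ := even_of_zsmul_add_zsmul_fn_eq_zero fn hrel h2R hP₀ h'
    exact ⟨⟨a'', by ring⟩, ⟨b'', by ring⟩⟩

/-- **Spanning**: if moreover `X` has `2^M · 2^M` elements, every `Q ∈ X` is `a • P₀ + b • fn P₀`
(the `4^M` combinations with `0 ≤ a, b < 2^M` are distinct). [cite: Rubin1999, Cor. 5.5] -/
theorem exists_eq_zsmul_add_zsmul_fn (hcard : Nat.card X = 2 ^ M * 2 ^ M) (Q : X) :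
    ∃ a b : ℤ, Q = a • P₀ + b • fn P₀ := by
  haveI : Finite X := Nat.finite_of_card_ne_zero (by rw [hcard]; positivity)
  letI := Fintype.ofFinite X
  let f : Fin (2 ^ M) × Fin (2 ^ M) → X := fun ab ↦ ((ab.1 : ℕ) : ℤ) • P₀ + ((ab.2 : ℕ) : ℤ) • fn P₀
  have hinj : Function.Injective f := by
    rintro ⟨a, b⟩ ⟨a', b'⟩ hab
    have h0 : (((a : ℕ) : ℤ) - ((a' : ℕ) : ℤ)) • P₀ + (((b : ℕ) : ℤ) - ((b' : ℕ) : ℤ)) • fn P₀ = 0 := by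
      have e : f (a, b) - f (a', b') = 0 := sub_eq_zero.mpr hab
      rw [← e]
      simp only [f, sub_smul]
      abel
    obtain ⟨hda, hdb⟩ := two_pow_dvd_of_zsmul_add_zsmul_fn_eq_zero fn hrel hkill hP₀ h0
    have ha := a.isLt; have ha' := a'.isLt; have hb := b.isLt; have hb' := b'.isLt
    have hN : ((2 ^ M : ℕ) : ℤ) = (2 : ℤ) ^ M := by push_cast; ring
    have e1 := Int.eq_zero_of_abs_lt_dvd hda (by rw [← hN, abs_sub_lt_iff]; omega)
    have e2 := Int.eq_zero_of_abs_lt_dvd hdb (by rw [← hN, abs_sub_lt_iff]; omega)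
    exact Prod.ext (Fin.ext (show (a : ℕ) = a' by omega)) (Fin.ext (show (b : ℕ) = b' by omega))
  have hbij : Function.Bijective f := (Fintype.bijective_iff_injective_and_card f).mpr
    ⟨hinj, by rw [Fintype.card_prod, Fintype.card_fin, ← Nat.card_eq_fintype_card, hcard]⟩
  obtain ⟨⟨a, b⟩, hab⟩ := hbij.2 Q
  exact ⟨a, b, hab.symm⟩

omit hrel hP₀ in
/-- **Every non-zero element of a `2`-group has a non-zero `2`-torsion multiple.** [folklore] -/
private theorem exists_two_torsion_multiple {D : X} (hD : D ≠ 0) :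
    ∃ e : ℕ, ((2 : ℤ) ^ e) • D ≠ 0 ∧ (2 : ℤ) • (((2 : ℤ) ^ e) • D) = 0 := by
  classical
  have hex : ∃ e : ℕ, ((2 : ℤ) ^ (e + 1)) • D = 0 :=
    ⟨M, by rw [pow_succ, mul_comm, mul_smul, hkill, smul_zero]⟩
  refine ⟨Nat.find hex, fun h ↦ ?_, by rw [smul_smul, ← pow_succ']; exact Nat.find_spec hex⟩
  rcases Nat.eq_zero_or_pos (Nat.find hex) with h0 | hpos
  · rw [h0, pow_zero, one_smul] at h; exact hD h
  · exact Nat.find_min hex (m := Nat.find hex - 1) (by omega) (by rwa [Nat.sub_add_cancel hpos])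

omit hrel hkill hP₀ in
/-- **Powers of an element fixing the `2`-torsion layer**: if `g` (acting distributively) fixes every `Q`
with `2Q = 0`, then `g ^ 2^k` fixes every `Q` with `2^{k+1} Q = 0`. [folklore] -/
private theorem pow_two_pow_smul_eq_self {G : Type*} [Group G] [DistribMulAction G X] (g : G)
    (hg : ∀ Q : X, (2 : ℤ) • Q = 0 → g • Q = Q) (k : ℕ) :
    ∀ Q : X, ((2 : ℤ) ^ (k + 1)) • Q = 0 → g ^ 2 ^ k • Q = Q := by
  induction k with
  | zero => intro Q hQ; rw [pow_zero, pow_one]; exact hg Q (by rwa [zero_add, pow_one] at hQ)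
  | succ k ih =>
    intro Q hQ
    have h2Q : g ^ 2 ^ k • ((2 : ℤ) • Q) = (2 : ℤ) • Q := ih _ (by rw [smul_smul, ← pow_succ]; exact hQ)
    have hR2 : (2 : ℤ) • (g ^ 2 ^ k • Q - Q) = 0 := by
      rw [smul_sub, sub_eq_zero, ← h2Q]; exact (map_zsmul (DistribSMul.toAddMonoidHom X (g ^ 2 ^ k)) 2 Q).symm
    have hR : g ^ 2 ^ k • (g ^ 2 ^ k • Q - Q) = g ^ 2 ^ k • Q - Q :=
      ih _ (by rw [pow_succ, mul_smul, hR2, smul_zero])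
    rw [pow_succ, pow_mul, sq, mul_smul]
    have e2 : (g ^ 2 ^ k • Q - Q) + (g ^ 2 ^ k • Q - Q) = 0 := by rw [← two_zsmul]; exact hR2
    calc g ^ 2 ^ k • (g ^ 2 ^ k • Q) = g ^ 2 ^ k • (Q + (g ^ 2 ^ k • Q - Q)) := by congr 1; abel
      _ = g ^ 2 ^ k • Q + (g ^ 2 ^ k • Q - Q) := by rw [smul_add, hR]
      _ = Q + ((g ^ 2 ^ k • Q - Q) + (g ^ 2 ^ k • Q - Q)) := by abel
      _ = Q := by rw [e2, add_zero]

end CMTorsionLine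

/-! ## §2 The curve level: `X = E[n]`, `n = 2^M` -/

namespace JZero
open CMTorsionLine

variable {K : Type u} [Field K] [CharZero K] (W : WeierstrassCurve K) [W.IsElliptic] (n : ℕ) [NeZero n] {M : ℕ}

omit [CharZero K] [W.IsElliptic] [NeZero n] in
/-- `2^M` kills `E[2^M]`. [cite: SilvermanAEC2009, Cor. III.6.4(b)] -/
theorem two_pow_zsmul_geomTorsion (hn : n = 2 ^ M) (Q : geomTorsion W (n : ℤ)) : ((2 : ℤ) ^ M) • Q = 0 := by
  apply Subtype.ext
  rw [AddSubgroupClass.coe_zsmul, ZeroMemClass.coe_zero, show (2 : ℤ) ^ M = (n : ℤ) by rw [hn]; push_cast; ring]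
  exact (mem_geomTorsion_iff W (n : ℤ) _).mp Q.2

/-- `#E[n] = n²` (from `E[n] ≃ ℤ/n × ℤ/n`, `TorsionPairingInvariance.nonempty_addEquiv_geomTorsion_zmod_prod`).
[cite: SilvermanAEC2009, Cor. III.6.4(b)] -/
theorem natCard_geomTorsion_eq_mul : Nat.card (geomTorsion W (n : ℤ)) = n * n := by
  obtain ⟨e⟩ := TorsionPairingInvariance.nonempty_addEquiv_geomTorsion_zmod_prod W n
  rw [Nat.card_congr e.toEquiv, Nat.card_prod, Nat.card_zmod]

/-- **An element of exact order `2^M` in `E[2^M]`.** [cite: SilvermanAEC2009, Cor. III.6.4(b)] -/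
theorem exists_two_pow_pred_zsmul_ne_zero (hn : n = 2 ^ M) (hM : 1 ≤ M) :
    ∃ P₀ : geomTorsion W (n : ℤ), ((2 : ℤ) ^ (M - 1)) • P₀ ≠ 0 := by
  obtain ⟨e⟩ := TorsionPairingInvariance.nonempty_addEquiv_geomTorsion_zmod_prod W n
  refine ⟨e.symm (1, 0), fun h ↦ ?_⟩
  have h1 : ((2 : ℤ) ^ (M - 1)) • ((1, 0) : ZMod n × ZMod n) = 0 := by
    rw [← e.apply_symm_apply (1, 0), ← map_zsmul, h, map_zero]
  have h2 : (((2 : ℤ) ^ (M - 1) : ℤ) : ZMod n) = 0 := by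
    have := congrArg Prod.fst h1
    rwa [Prod.smul_fst, Prod.fst_zero, zsmul_eq_mul, mul_one] at this
  have h3 : ((2 ^ (M - 1) : ℕ) : ZMod n) = 0 := by exact_mod_cast h2
  rw [ZMod.natCast_eq_zero_iff, hn, Nat.pow_dvd_pow_iff_le_right (by norm_num)] at h3
  omega

/-- **(α) A basis pair `{P₀, fn P₀}` of `E[2^M]` over `ℤ/2^M`** for any additive `fn` with `fn² + fn + 1 = 0`:
`E[2^M]` is free of rank one over `(ℤ/2^M)[fn] ≅ 𝒪/2^M`. [cite: Rubin1999, Cor. 5.5] [cite: SilvermanAEC2009, Cor. III.6.4(b)] -/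
theorem exists_basis_pair_geomTorsion_two_pow (hn : n = 2 ^ M) (hM : 1 ≤ M)
    (fn : geomTorsion W (n : ℤ) →+ geomTorsion W (n : ℤ)) (hrel : ∀ Q, fn (fn Q) + fn Q + Q = 0) :
    ∃ P₀ : geomTorsion W (n : ℤ), ((2 : ℤ) ^ (M - 1)) • P₀ ≠ 0 ∧
      (∀ Q, ∃ a b : ℤ, Q = a • P₀ + b • fn P₀) ∧
      (∀ a b : ℤ, a • P₀ + b • fn P₀ = 0 → (2 : ℤ) ^ M ∣ a ∧ (2 : ℤ) ^ M ∣ b) := by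
  obtain ⟨P₀, hP₀⟩ := exists_two_pow_pred_zsmul_ne_zero W n hn hM
  have hkill := two_pow_zsmul_geomTorsion W n hn
  have hcard : Nat.card (geomTorsion W (n : ℤ)) = 2 ^ M * 2 ^ M := by
    rw [natCard_geomTorsion_eq_mul, hn]
  exact ⟨P₀, hP₀, exists_eq_zsmul_add_zsmul_fn fn hrel hkill hP₀ hcard,
    fun a b h ↦ two_pow_dvd_of_zsmul_add_zsmul_fn_eq_zero fn hrel hkill hP₀ h⟩

section Line

variable (fn : geomTorsion W (n : ℤ) →+ geomTorsion W (n : ℤ)) (hn : n = 2 ^ M) (hM : 1 ≤ M)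
  (hrel : ∀ Q, fn (fn Q) + fn Q + Q = 0)
  (hfn : ∀ (g : absoluteGaloisGroup K) (Q : geomTorsion W (n : ℤ)), fn (g • Q) = g • fn Q)
include hn hM hrel hfn

/-- **(α) Every `σ ∈ Γ_K` acts on `E[2^M]` as `a + b · fn`** when `fn` is `Γ_K`-equivariant
(`Gal(K(E[2^M])/K) ↪ (𝒪/2^M)^×`). [cite: Rubin1999, Cor. 5.5, Cor. 5.20] -/
theorem smul_eq_zsmul_add_zsmul_fn (g : absoluteGaloisGroup K) :
    ∃ a b : ℤ, ∀ Q : geomTorsion W (n : ℤ), g • Q = a • Q + b • fn Q := by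
  obtain ⟨P₀, -, hspan, -⟩ := exists_basis_pair_geomTorsion_two_pow W n hn hM fn hrel
  obtain ⟨a, b, hab⟩ := hspan (g • P₀)
  have hsm : ∀ (c : ℤ) (P : geomTorsion W (n : ℤ)), g • (c • P) = c • (g • P) := fun c P ↦
    map_zsmul (DistribSMul.toAddMonoidHom _ g) c P
  have hff : fn (fn P₀) = -fn P₀ - P₀ := by rw [← sub_eq_zero, ← hrel P₀]; abel
  refine ⟨a, b, fun Q ↦ ?_⟩
  obtain ⟨c, d, rfl⟩ := hspan Q
  rw [smul_add, hsm, hsm, ← hfn, hab]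
  simp only [map_add, map_zsmul, smul_add, hff, smul_sub, smul_neg, smul_smul]
  module

/-- **(α) Any two elements of `Γ_K` commute on `E[2^M]`** (both are polynomials in `fn`).
[cite: Rubin1999, Cor. 5.5, Cor. 5.20] -/
theorem smul_comm_geomTorsion_two_pow (g h : absoluteGaloisGroup K) (Q : geomTorsion W (n : ℤ)) : g • h • Q = h • g • Q := by
  obtain ⟨a, b, hab⟩ := smul_eq_zsmul_add_zsmul_fn W n fn hn hM hrel hfn g
  obtain ⟨c, d, hcd⟩ := smul_eq_zsmul_add_zsmul_fn W n fn hn hM hrel hfn h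
  have hff : fn (fn Q) = -fn Q - Q := by rw [← sub_eq_zero, ← hrel Q]; abel
  have hsm : ∀ (k : absoluteGaloisGroup K) (c : ℤ) (P : geomTorsion W (n : ℤ)), k • (c • P) = c • (k • P) :=
    fun k c P ↦ map_zsmul (DistribSMul.toAddMonoidHom _ k) c P
  have hg' : g • h • Q = c • (a • Q + b • fn Q) + d • fn (a • Q + b • fn Q) := by
    rw [hcd Q, smul_add, hsm, hsm, ← hfn, hab Q]
  have hh' : h • g • Q = a • (c • Q + d • fn Q) + b • fn (c • Q + d • fn Q) := by
    rw [hab Q, smul_add, hsm, hsm, ← hfn, hcd Q]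
  rw [hg', hh']
  simp only [smul_add, map_add, map_zsmul, hff, smul_sub, smul_neg, smul_smul]
  module

/-- ★ **(α) `Gal(K(E[2^M])/K)` is abelian**: `ab = ba·c` with `c ∈ Γ_{K(E[2^M])}` (the commutator acts
trivially) — the `hab` input of the tree's Sah form at `2`-power level. [cite: Rubin1999, Cor. 5.20, Lemma 6.2 (i)] -/
theorem exists_mem_torsionFixing_mul_eq_two_pow (a b : absoluteGaloisGroup K) :
    ∃ c ∈ torsionFixing W (n : ℤ), a * b = b * a * c := by
  refine ⟨a⁻¹ * b⁻¹ * a * b, (mem_torsionFixing_iff W (n : ℤ)).2 fun P ↦ ?_, by group⟩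
  rw [mul_smul, mul_smul, mul_smul, smul_comm_geomTorsion_two_pow W n fn hn hM hrel hfn a b P,
    inv_smul_smul, inv_smul_smul]

/-- **(β) An element moving some `2`-torsion point has `P ↦ z • P - P` bijective on `E[2^M]`**: `z` acts as
`a + b·fn` with `(a - 1, b) ≢ (0, 0) (mod 2)` — on `E[2]` it is the order-`3` scalar `fn` or `fn²` — so `z - 1`
is a UNIT of `𝒪/2^M`. D440: `hzR` is genuine (else `z = 1` fails). [cite: Rubin1999, Lemma 6.1, Lemma 6.2 (i)] -/
theorem bijective_smul_sub_of_two_torsion_ne (z : absoluteGaloisGroup K) {R : geomTorsion W (n : ℤ)}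
    (hR2 : (2 : ℤ) • R = 0) (hzR : z • R ≠ R) :
    Function.Bijective fun P : geomTorsion W (n : ℤ) ↦ z • P - P := by
  haveI : Finite (geomTorsion W (n : ℤ)) :=
    finite_torsionPoints_holds W (AlgebraicClosure K) (Int.natCast_ne_zero.mpr (NeZero.ne n))
  have hkill := two_pow_zsmul_geomTorsion W n hn
  obtain ⟨a, b, hab⟩ := smul_eq_zsmul_add_zsmul_fn W n fn hn hM hrel hfn z
  have hsm : ∀ (c : ℤ) (P : geomTorsion W (n : ℤ)), z • (c • P) = c • (z • P) := fun c P ↦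
    map_zsmul (DistribSMul.toAddMonoidHom _ z) c P
  refine Finite.injective_iff_bijective.1 fun P Q hPQ ↦ ?_
  by_contra hne
  -- `D := P - Q ≠ 0` is fixed by `z`; its `2`-torsion multiple `R'` too
  have hD : z • (P - Q) = P - Q := by
    have h : z • P - P = z • Q - Q := hPQ
    rw [smul_sub, sub_eq_sub_iff_sub_eq_sub.mp h]
  obtain ⟨e, hR', hR'2⟩ := exists_two_torsion_multiple hkill (sub_ne_zero.mpr hne)
  have hzR' : z • (((2 : ℤ) ^ e) • (P - Q)) = ((2 : ℤ) ^ e) • (P - Q) := by rw [hsm, hD]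
  have h0 : (a - 1) • (((2 : ℤ) ^ e) • (P - Q)) + b • fn (((2 : ℤ) ^ e) • (P - Q)) = 0 := by
    rw [sub_smul, one_smul, sub_add_eq_add_sub, ← hab, hzR', sub_self]
  obtain ⟨⟨a', ha'⟩, ⟨b', rfl⟩⟩ := even_of_zsmul_add_zsmul_fn_eq_zero fn hrel hR'2 hR' h0
  -- `(a - 1, b)` are even, so `z` fixes every `2`-torsion point, in particular `R`
  apply hzR
  have hfR2 : (2 : ℤ) • fn R = 0 := by rw [← map_zsmul, hR2, map_zero]
  rw [hab, show a = 2 * a' + 1 by linarith, add_smul, one_smul, mul_comm (2 : ℤ) a', mul_smul, hR2,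
    smul_zero, zero_add, mul_comm (2 : ℤ) b', mul_smul, hfR2, smul_zero, add_zero]

/-- ★ **(β) If `Γ_K` has no non-zero fixed vector on `E[2^M]`, some `z ∈ Γ_K` has `P ↦ z • P - P`
bijective on `E[2^M]`.** [cite: Rubin1999, Lemma 6.1, Lemma 6.2 (i)] -/
theorem exists_bijective_smul_sub_two_pow
    (hnofix : ∀ Q : geomTorsion W (n : ℤ), (∀ g : absoluteGaloisGroup K, g • Q = Q) → Q = 0) :
    ∃ z : absoluteGaloisGroup K, Function.Bijective fun P : geomTorsion W (n : ℤ) ↦ z • P - P := by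
  obtain ⟨P₀, hP₀⟩ := exists_two_pow_pred_zsmul_ne_zero W n hn hM
  have hR2 : (2 : ℤ) • (((2 : ℤ) ^ (M - 1)) • P₀) = 0 := by
    rw [smul_smul, ← pow_succ', Nat.sub_add_cancel hM]; exact two_pow_zsmul_geomTorsion W n hn P₀
  have hz : ∃ z : absoluteGaloisGroup K, z • (((2 : ℤ) ^ (M - 1)) • P₀) ≠ ((2 : ℤ) ^ (M - 1)) • P₀ := by
    by_contra h
    push Not at h
    exact hP₀ (hnofix _ h)
  obtain ⟨z, hz⟩ := hz
  exact ⟨z, bijective_smul_sub_of_two_torsion_ne W n fn hn hM hrel hfn z hR2 hz⟩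

/-- ★★ **(γ) `ker (H¹(K, E[2^M]) → H¹(K(E[2^M]), E[2^M])) = 0`** for a curve with an equivariant CM operator of
order `3` on `E[2^M]` and no non-zero `Γ_K`-fixed vector there: the tree's Sah form
`Rubin1987.subgroupResKer_torsionFixing_eq_bot` fed by (α) `hab`, (β) `hbij` and `isOpen_torsionFixing` (the open
input consumed there). [cite: Rubin1999, Lemma 6.1, Lemma 6.2 (i), Thm. 6.5] -/
theorem subgroupResKer_torsionFixing_two_pow_eq_bot
    (hnofix : ∀ Q : geomTorsion W (n : ℤ), (∀ g : absoluteGaloisGroup K, g • Q = Q) → Q = 0) :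
    subgroupResKer (geomTorsion W (n : ℤ)) (torsionFixing W (n : ℤ)) = ⊥ := by
  obtain ⟨z, hz⟩ := exists_bijective_smul_sub_two_pow W n fn hn hM hrel hfn hnofix
  exact Rubin1987.subgroupResKer_torsionFixing_eq_bot W (n : ℤ)
    (isOpen_torsionFixing W (Int.natCast_ne_zero.mpr (NeZero.ne n)))
    (exists_mem_torsionFixing_mul_eq_two_pow W n fn hn hM hrel hfn) hz

/-- **(γ) A class of `H¹(K, E[2^M])` vanishing on `Γ_{K(E[2^M])}` is zero** (h1Eval faithfulness at `2`-power
level). [cite: Rubin1999, Thm. 6.5 (proof)] [cite: GrossLMS1991, §9] -/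
theorem eq_zero_of_forall_h1Eval_eq_zero_two_pow
    (hnofix : ∀ Q : geomTorsion W (n : ℤ), (∀ g : absoluteGaloisGroup K, g • Q = Q) → Q = 0)
    {x : galH1Torsion W (n : ℤ)} (hx : ∀ ρ ∈ torsionFixing W (n : ℤ), h1Eval W (n : ℤ) x ρ = 0) :
    x = 0 :=
  Rubin1987.eq_zero_of_forall_h1Eval_eq_zero W (n : ℤ)
    (subgroupResKer_torsionFixing_two_pow_eq_bot W n fn hn hM hrel hfn hnofix) hx

end Line

omit [CharZero K] [W.IsElliptic] [NeZero n] in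
/-- **(δ) An element fixing `E[2]` pointwise has `2`-power order on `E[2^M]`**: `g ^ 2^(M-1) ∈ Γ_{K(E[2^M])}`
(the kernel of `Aut E[2^M] → Aut E[2]` is a `2`-group; the unique cubic subfield of `K(E[2^∞])` is `K(E[2])`).
The hypothesis is stated on the `2`-torsion INSIDE `E[2^M]`; see `smul_eq_self_of_mem_torsionFixing_two`.
[cite: GrossLMS1991, §9 (Prop. 9.1)] -/
theorem pow_two_pow_mem_torsionFixing_of_forall_two_torsion (hn : n = 2 ^ M) (hM : 1 ≤ M)
    (g : absoluteGaloisGroup K) (hg : ∀ Q : geomTorsion W (n : ℤ), (2 : ℤ) • Q = 0 → g • Q = Q) :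
    g ^ 2 ^ (M - 1) ∈ torsionFixing W (n : ℤ) := by
  refine (mem_torsionFixing_iff W (n : ℤ)).2 fun Q ↦ pow_two_pow_smul_eq_self g hg (M - 1) Q ?_
  rw [Nat.sub_add_cancel hM]
  exact two_pow_zsmul_geomTorsion W n hn Q

omit [CharZero K] [W.IsElliptic] [NeZero n] in
/-- The bridge for (δ): `g ∈ Γ_{K(E[2])}` fixes the `2`-torsion inside `E[n]`. [cite: SilvermanAEC2009, Cor. III.6.4(b)] -/
theorem smul_eq_self_of_mem_torsionFixing_two (g : absoluteGaloisGroup K)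
    (hg : g ∈ torsionFixing W ((2 : ℕ) : ℤ)) (Q : geomTorsion W (n : ℤ)) (hQ : (2 : ℤ) • Q = 0) :
    g • Q = Q := by
  have hmem : (Q : geomPoints W) ∈ geomTorsion W ((2 : ℕ) : ℤ) := by
    rw [mem_geomTorsion_iff, Nat.cast_ofNat, ← AddSubgroupClass.coe_zsmul, hQ, ZeroMemClass.coe_zero]
  have h := smul_eq_of_mem_torsionFixing W ((2 : ℕ) : ℤ) hg ⟨Q, hmem⟩
  apply Subtype.ext
  rw [AddSubgroup.torsionBy.coe_smul]
  exact congrArg Subtype.val h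

/-! ### The `j = 0` discharge of the no-fixed-vector input -/

section JZeroCurve

variable (fn : geomTorsion W (n : ℤ) →+ geomTorsion W (n : ℤ)) {b : K} (hW : W = ⟨0, 0, 0, 0, b⟩)
  (hb : ∀ x : K, x ^ 3 + b ≠ 0) (hn : n = 2 ^ M) (hM : 1 ≤ M) (hrel : ∀ Q, fn (fn Q) + fn Q + Q = 0)
  (hfn : ∀ (g : absoluteGaloisGroup K) (Q : geomTorsion W (n : ℤ)), fn (g • Q) = g • fn Q)
include hW hb hn hM hrel hfn

/-- ★★ **(γ) for `y² = x³ + b`, `x³ + b` rootless over `K`**: `H¹(K(E[2^M])/K, E[2^M]) = 0`, the no-fixed-vector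
input being the tree's `JZero.geomTorsion_eq_zero_of_forall_smul_eq`. [cite: Rubin1999, Lemma 6.2 (i)] -/
theorem subgroupResKer_torsionFixing_two_pow_eq_bot_of_no_cubeRoot :
    subgroupResKer (geomTorsion W (n : ℤ)) (torsionFixing W (n : ℤ)) = ⊥ := by
  subst hW
  exact subgroupResKer_torsionFixing_two_pow_eq_bot _ n fn hn hM hrel hfn
    fun Q hQ ↦ JZero.geomTorsion_eq_zero_of_forall_smul_eq hb hn Q hQ

end JZeroCurve

end JZero

end Literature.NumberTheory.EllipticCurves

end
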